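import Summits.Ventures.HodgeRepro2.T5SU11JacobiWeightDerivAll
import Summits.Ventures.HodgeRepro2.T5SU11JacobiWeightAsymptotic
import Summits.Ventures.HodgeRepro2.T5SU11SphericalGrowth

/-!
# All moments of the phase are asymptotically exponential: `kⁿ ⟨(log|a|)ⁿ⟩_{k,λ} → n!` for every `λ`

For the probability measure `m_k φ_λ dν / m̂_k(λ)` on `G` the phase `s(g) = log|a(g)|` has, at `λ = 0`, the
exponential law of rate `k − 2` with moments `n!/(k − 2)ⁿ` (`T5SU11PhaseLawLintegral`), and for every `λ`
the mean `∼ 1/k` (`T5SU11JacobiMeanPhaseAsymptotic`). This file gives the asymptotics of EVERY moment for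
EVERY real parameter `λ`: in the Laplace form of the moments (`T5SU11JacobiWeightDerivAll`), the
substitution `s = u/(k − 2)` turns

  `(k − 2)^{n+1} ∫_0^∞ sⁿ e^{−(k−2)s} Φ_λ(s) ds = ∫_0^∞ uⁿ e^{−u} Φ_λ(u/(k − 2)) du`   (`scaled_phase_moment_eq`)

and dominated convergence gives the limit `∫_0^∞ uⁿ e^{−u} du = n!` (`tendsto_scaled_phase_integral`):
the dominating function is `2^{|λ−1|} uⁿ e^{−u/2}` for `k ≥ 2 + 2|λ − 1|`, from the phase bound
**`Φ_λ(s) ≤ 2^{|λ−1|} e^{|λ−1| s}`** (`sphPhase_le_exp`: the Cartan coordinate satisfies `t(s) ≤ s + log 2`,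
`cartanOfPhase_le`, and `φ_λ(a_t) ≤ e^{|λ−1| t}` is `T5SU11SphericalGrowth`), and `Φ_λ(u/(k−2)) → Φ_λ(0) = 1`.
Hence, on `G`,

  **`(k − 2)^{n+1} ∫_G (log|a|)ⁿ m_k φ_λ dν → 2π n!`**,  `k^{n+1} ∫_G (log|a|)ⁿ m_k φ_λ dν → 2π n!`,
  **`kⁿ ⟨(log|a|)ⁿ⟩_{k,λ} → n!`**   (`tendsto_scaled_phase_moment`, `tendsto_pow_mul_phase_moment`,
  `tendsto_pow_mul_normalized_phase_moment`)

— the rescaled phase `k · log|a|` converges in every moment to the standard exponential law, for every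
spectral parameter; the case `n = 1` is `T5SU11JacobiMeanPhaseAsymptotic`. Nothing is claimed about (N).

Blind lane: Mathlib + the HodgeRepro2 prefix only; no sorry; axioms ⊆ {propext, Classical.choice,
Quot.sound}.
-/

namespace Summit.Ventures.HodgeRepro2.T5SU11JacobiPhaseMomentsAsymptotic

open MeasureTheory MeasureTheory.Measure Metric Set Filter Topology
open T5SU11Unimodular T5SU11Fibration T5SU11Cartan T5SU11OneParameter T5SU11CartanProjection T5HaarCircle
  T5BergmanCoefficient T5SU11FibrationHaar T5SU11SphericalFunction T5SU11SphericalSymmetry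
  T5SU11SphericalBounds T5SU11SphericalContinuous T5SU11JacobiIwasawa T5SU11JacobiTransform
  T5SU11JacobiWeight T5SU11KFiniteMajorantPow T5SU11JacobiWeightDeriv T5SU11PhaseLaw
  T5SU11PhaseLawLintegral T5SU11JacobiLaplacePhase T5SU11JacobiWeightDerivAll
  T5SU11JacobiWeightAsymptotic T5SU11SphericalGrowth
open scoped Real

/-! ### The Euler integrals -/

/-- `uⁿ e^{−u}` is integrable on `(0, ∞)`. -/
theorem integrableOn_pow_mul_exp_neg_Ioi (n : ℕ) :
    IntegrableOn (fun u : ℝ => u ^ n * Real.exp (-u)) (Ioi 0) := by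
  have h := Real.GammaIntegral_convergent (s := (n : ℝ) + 1) (by positivity)
  rw [add_sub_cancel_right] at h
  refine h.congr_fun (fun u _ => ?_) measurableSet_Ioi
  show Real.exp (-u) * u ^ (n : ℝ) = u ^ n * Real.exp (-u)
  rw [Real.rpow_natCast, mul_comm]

/-- `uⁿ e^{−u/2}` is integrable on `(0, ∞)`. -/
theorem integrableOn_pow_mul_exp_neg_half_Ioi (n : ℕ) :
    IntegrableOn (fun u : ℝ => u ^ n * Real.exp (-(u / 2))) (Ioi 0) := by
  have h := integrableOn_pow_mul_exp_neg n (k := 5 / 2) (by norm_num)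
  refine h.congr_fun (fun u _ => ?_) measurableSet_Ioi
  show u ^ n * Real.exp (-(5 / 2 * u)) * Real.exp (2 * u) = u ^ n * Real.exp (-(u / 2))
  rw [mul_assoc, ← Real.exp_add]
  congr 2
  ring

/-- `∫_0^∞ uⁿ e^{−u} du = n!`. -/
theorem integral_pow_mul_exp_neg_Ioi (n : ℕ) :
    ∫ u in Ioi (0 : ℝ), u ^ n * Real.exp (-u) = (n.factorial : ℝ) := by
  have h := integral_pow_mul_exp_neg_mul_Ioi n (r := 1) one_pos
  simp only [one_mul, one_pow, div_one] at h
  exact h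

/-- `k − 2 → ∞` as `k → ∞`. -/
theorem tendsto_sub_two_atTop : Tendsto (fun k : ℝ => k - 2) atTop atTop :=
  tendsto_atTop_atTop.mpr fun b => ⟨b + 2, fun k hk => by linarith⟩

/-- `(k/(k − 2))^{n+1} → 1`. -/
theorem tendsto_div_sub_two_pow (n : ℕ) :
    Tendsto (fun k : ℝ => (k / (k - 2)) ^ (n + 1)) atTop (𝓝 1) := by
  have h1 : Tendsto (fun k : ℝ => k / (k - 2)) atTop (𝓝 1) := by
    have h0 : Tendsto (fun k : ℝ => 2 / (k - 2)) atTop (𝓝 0) := tendsto_sub_two_atTop.const_div_atTop 2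
    have h1 : Tendsto (fun k : ℝ => 1 + 2 / (k - 2)) atTop (𝓝 (1 + 0)) := tendsto_const_nhds.add h0
    rw [add_zero] at h1
    refine h1.congr' ?_
    filter_upwards [eventually_gt_atTop (2 : ℝ)] with k hk
    have : k - 2 ≠ 0 := by linarith
    field_simp
    ring
  simpa using h1.pow (n + 1)

/-! ### The Cartan coordinate of the phase: `0 ≤ t(s) ≤ s + log 2` -/

/-- `0 ≤ t(s)`. -/
theorem cartanOfPhase_nonneg (s : ℝ) : 0 ≤ cartanOfPhase s := by
  unfold cartanOfPhase
  exact Real.arsinh_nonneg_iff.mpr (Real.sqrt_nonneg _)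

/-- **`t(s) ≤ s + log 2`** for `s ≥ 0` (`e^t ≤ 2 cosh t = 2 e^s`). -/
theorem cartanOfPhase_le {s : ℝ} (hs : 0 ≤ s) : cartanOfPhase s ≤ s + Real.log 2 := by
  unfold cartanOfPhase
  rw [← Real.arsinh_sinh (s + Real.log 2), Real.arsinh_le_arsinh, Real.sinh_eq, Real.exp_add,
    Real.exp_log two_pos, Real.exp_neg, Real.exp_add, Real.exp_log two_pos]
  set E := Real.exp s with hE
  have hE1 : 1 ≤ E := by
    rw [hE]
    exact Real.one_le_exp hs
  have hinv : (E * 2) * (E * 2)⁻¹ = 1 := mul_inv_cancel₀ (by positivity)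
  have hinv_le : (E * 2)⁻¹ ≤ 1 / 2 := by
    rw [inv_le_comm₀ (by positivity) (by norm_num)]
    linarith
  have hy : 0 ≤ (E * 2 - (E * 2)⁻¹) / 2 := by linarith
  rw [Real.sqrt_le_left hy, show Real.exp (2 * s) = E * E by rw [two_mul, Real.exp_add]]
  nlinarith [sq_nonneg ((E * 2)⁻¹), hinv]

section measure

variable [MeasurableSpace Circle] [BorelSpace Circle]

/-- **The phase bound**: `Φ_λ(s) ≤ 2^{|λ−1|} e^{|λ−1| s}` for `s ≥ 0` (written with `2^{|λ−1|} = e^{|λ−1| log 2}`). -/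
theorem sphPhase_le_exp (lam : ℝ) {s : ℝ} (hs : 0 ≤ s) :
    sphPhase lam s ≤ Real.exp (|lam - 1| * Real.log 2) * Real.exp (|lam - 1| * s) := by
  unfold sphPhase
  calc sph lam (hyp (cartanOfPhase s)) ≤ Real.exp (|lam - 1| * cartanOfPhase s) :=
        sph_hyp_le_exp_abs_sub_one lam (cartanOfPhase_nonneg s)
    _ ≤ Real.exp (|lam - 1| * (s + Real.log 2)) :=
        Real.exp_le_exp.mpr (mul_le_mul_of_nonneg_left (cartanOfPhase_le hs) (abs_nonneg _))
    _ = Real.exp (|lam - 1| * Real.log 2) * Real.exp (|lam - 1| * s) := by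
        rw [← Real.exp_add]
        congr 1
        ring

/-! ### The substitution `s = u/(k − 2)` -/

omit [BorelSpace Circle] in
/-- **The scaled moment integral**: for `k > 2`,
`(k − 2)^{n+1} ∫_0^∞ sⁿ e^{−(k−2)s} Φ_λ(s) ds = ∫_0^∞ uⁿ e^{−u} Φ_λ(u/(k − 2)) du`. -/
theorem scaled_phase_moment_eq (lam : ℝ) (n : ℕ) {k : ℝ} (hk : 2 < k) :
    (k - 2) ^ (n + 1) * ∫ s in Ioi (0 : ℝ), s ^ n * Real.exp (-((k - 2) * s)) * sphPhase lam s
      = ∫ u in Ioi (0 : ℝ), u ^ n * Real.exp (-u) * sphPhase lam (u / (k - 2)) := by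
  have hc : 0 < k - 2 := by linarith
  have h := integral_comp_mul_left_Ioi (fun u : ℝ => u ^ n * Real.exp (-u) * sphPhase lam (u / (k - 2)))
    0 hc
  rw [mul_zero, smul_eq_mul] at h
  have e : ∀ x : ℝ, (fun u : ℝ => u ^ n * Real.exp (-u) * sphPhase lam (u / (k - 2))) ((k - 2) * x)
      = (k - 2) ^ n * (x ^ n * Real.exp (-((k - 2) * x)) * sphPhase lam x) := fun x => by
    simp only
    rw [mul_div_cancel_left₀ _ hc.ne', mul_pow]
    ring
  simp_rw [e] at h
  rw [integral_const_mul] at h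
  -- `h : (k − 2)ⁿ · I = (k − 2)⁻¹ · J`
  have hc' : (k - 2) ≠ 0 := hc.ne'
  rw [pow_succ]
  calc (k - 2) ^ n * (k - 2) * ∫ s in Ioi (0 : ℝ), s ^ n * Real.exp (-((k - 2) * s)) * sphPhase lam s
      = (k - 2) * ((k - 2) ^ n * ∫ s in Ioi (0 : ℝ), s ^ n * Real.exp (-((k - 2) * s)) * sphPhase lam s) := by
        ring
    _ = (k - 2) * ((k - 2)⁻¹ * ∫ u in Ioi (0 : ℝ), u ^ n * Real.exp (-u) * sphPhase lam (u / (k - 2))) := by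
        rw [h]
    _ = ∫ u in Ioi (0 : ℝ), u ^ n * Real.exp (-u) * sphPhase lam (u / (k - 2)) := by
        rw [← mul_assoc, mul_inv_cancel₀ hc', one_mul]

/-! ### Dominated convergence -/

/-- **`∫_0^∞ uⁿ e^{−u} Φ_λ(u/(k − 2)) du → n!`** as `k → ∞`, for every `λ` (dominated convergence with
the bound `2^{|λ−1|} uⁿ e^{−u/2}` for `k ≥ 2 + 2|λ − 1|`, and `Φ_λ(u/(k − 2)) → Φ_λ(0) = 1`). -/
theorem tendsto_scaled_phase_integral (lam : ℝ) (n : ℕ) :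
    Tendsto (fun k : ℝ => ∫ u in Ioi (0 : ℝ), u ^ n * Real.exp (-u) * sphPhase lam (u / (k - 2)))
      atTop (𝓝 (n.factorial : ℝ)) := by
  set C : ℝ := Real.exp (|lam - 1| * Real.log 2) with hC
  have hlim := tendsto_integral_filter_of_dominated_convergence (μ := volume.restrict (Ioi (0 : ℝ)))
    (l := atTop) (F := fun k u => u ^ n * Real.exp (-u) * sphPhase lam (u / (k - 2)))
    (f := fun u => u ^ n * Real.exp (-u)) (fun u => C * (u ^ n * Real.exp (-(u / 2))))
    (Filter.Eventually.of_forall fun k => ?_) ?_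
    ((integrableOn_pow_mul_exp_neg_half_Ioi n).const_mul C) ?_
  · rwa [integral_pow_mul_exp_neg_Ioi n] at hlim
  · exact (((continuous_id.pow n).mul (Real.continuous_exp.comp continuous_neg)).mul
      ((continuous_sphPhase lam).comp (continuous_id.div_const _))).aestronglyMeasurable
  · filter_upwards [eventually_gt_atTop (2 + 2 * |lam - 1|)] with k hk
    filter_upwards [ae_restrict_mem measurableSet_Ioi] with u hu
    rw [mem_Ioi] at hu
    have hk2 : 0 < k - 2 := by linarith [abs_nonneg (lam - 1)]
    have hp : 0 ≤ u ^ n * Real.exp (-u) := mul_nonneg (pow_nonneg hu.le n) (Real.exp_pos _).le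
    rw [Real.norm_of_nonneg (mul_nonneg hp (sphPhase_pos lam _).le)]
    have hΦ : sphPhase lam (u / (k - 2)) ≤ C * Real.exp (u / 2) := by
      refine (sphPhase_le_exp lam (div_nonneg hu.le hk2.le)).trans ?_
      refine mul_le_mul_of_nonneg_left (Real.exp_le_exp.mpr ?_) (Real.exp_pos _).le
      rw [mul_div_assoc', div_le_div_iff₀ hk2 two_pos]
      nlinarith [abs_nonneg (lam - 1)]
    calc u ^ n * Real.exp (-u) * sphPhase lam (u / (k - 2))
        ≤ u ^ n * Real.exp (-u) * (C * Real.exp (u / 2)) := mul_le_mul_of_nonneg_left hΦ hp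
      _ = C * (u ^ n * (Real.exp (-u) * Real.exp (u / 2))) := by ring
      _ = C * (u ^ n * Real.exp (-(u / 2))) := by
          rw [← Real.exp_add]
          congr 3
          ring
  · refine Filter.Eventually.of_forall fun u => ?_
    have hdiv : Tendsto (fun k : ℝ => u / (k - 2)) atTop (𝓝 0) :=
      tendsto_sub_two_atTop.const_div_atTop u
    have hΦ : Tendsto (fun k : ℝ => sphPhase lam (u / (k - 2))) atTop (𝓝 (sphPhase lam 0)) :=
      ((continuous_sphPhase lam).tendsto 0).comp hdiv
    rw [sphPhase_zero] at hΦ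
    simpa using tendsto_const_nhds.mul hΦ

/-! ### The moments on `G` -/

/-- **`(k − 2)^{n+1} ∫_G (log|a|)ⁿ m_k φ_λ dν → 2π n!`** as `k → ∞`, for every `λ`. -/
theorem tendsto_scaled_phase_moment (lam : ℝ) (n : ℕ) :
    Tendsto (fun k : ℝ => (k - 2) ^ (n + 1)
        * ∫ g, Real.log ‖mat g 0 0‖ ^ n * ((1 - ‖orbit g‖ ^ 2) ^ (k / 2) * sph lam g) ∂(nu haarCircle))
      atTop (𝓝 (2 * π * (n.factorial : ℝ))) := by
  have h := (tendsto_scaled_phase_integral lam n).const_mul (2 * π)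
  refine h.congr' ?_
  filter_upwards [eventually_gt_atTop (max 2 (max lam (2 - lam)))] with k hk
  rw [max_lt_iff, max_lt_iff] at hk
  rw [integral_log_pow_mul_orbit_rpow_mul_sph_eq_phase lam n (by linarith) (by linarith) (by linarith),
    ← scaled_phase_moment_eq lam n hk.1]
  ring

/-- **`k^{n+1} ∫_G (log|a|)ⁿ m_k φ_λ dν → 2π n!`** as `k → ∞`, for every `λ`. -/
theorem tendsto_pow_mul_phase_moment (lam : ℝ) (n : ℕ) :
    Tendsto (fun k : ℝ => k ^ (n + 1)
        * ∫ g, Real.log ‖mat g 0 0‖ ^ n * ((1 - ‖orbit g‖ ^ 2) ^ (k / 2) * sph lam g) ∂(nu haarCircle))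
      atTop (𝓝 (2 * π * (n.factorial : ℝ))) := by
  have h := (tendsto_div_sub_two_pow n).mul (tendsto_scaled_phase_moment lam n)
  rw [one_mul] at h
  refine h.congr' ?_
  filter_upwards [eventually_gt_atTop (2 : ℝ)] with k hk
  have : k - 2 ≠ 0 := by linarith
  rw [div_pow, ← mul_assoc, div_mul_cancel₀ _ (pow_ne_zero _ this)]

/-- **ALL NORMALISED MOMENTS OF THE PHASE ARE ASYMPTOTICALLY THOSE OF `Exp(k)`**: for every `λ`,
`kⁿ ⟨(log|a|)ⁿ⟩_{k,λ} = kⁿ · (∫_G (log|a|)ⁿ m_k φ_λ dν)/m̂_k(λ) → n!` as `k → ∞`. -/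
theorem tendsto_pow_mul_normalized_phase_moment (lam : ℝ) (n : ℕ) :
    Tendsto (fun k : ℝ => k ^ n
        * ((∫ g, Real.log ‖mat g 0 0‖ ^ n * ((1 - ‖orbit g‖ ^ 2) ^ (k / 2) * sph lam g) ∂(nu haarCircle))
          / ∫ g, (1 - ‖orbit g‖ ^ 2) ^ (k / 2) * sph lam g ∂(nu haarCircle)))
      atTop (𝓝 (n.factorial : ℝ)) := by
  have hpi : (2 * π : ℝ) ≠ 0 := by positivity
  have h := (tendsto_pow_mul_phase_moment lam n).div (tendsto_mul_jacobi_weight lam) hpi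
  rw [show 2 * π * (n.factorial : ℝ) / (2 * π) = n.factorial by field_simp] at h
  refine h.congr' ?_
  filter_upwards [eventually_gt_atTop (max 2 (max lam (2 - lam)))] with k hk
  rw [max_lt_iff, max_lt_iff] at hk
  have hk0 : k ≠ 0 := by linarith
  have hm : ∫ g, (1 - ‖orbit g‖ ^ 2) ^ (k / 2) * sph lam g ∂(nu haarCircle) ≠ 0 :=
    (jacobi_pos (by linarith) (by linarith) (by linarith)).ne'
  simp only [Pi.div_apply]
  field_simp
  ring

end measure

end Summit.Ventures.HodgeRepro2.T5SU11JacobiPhaseMomentsAsymptotic
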